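import Summits.Ventures.PercRepro.C041BlockMapHangSets
import Summits.Ventures.PercRepro.C041MultiExitCoincident

/-!
# ROW C-041 — THEOREM (HANG): block maps compose along a cut vertex — the block map of a host `Zb` hung at a
vertex `v` of a host `Za` is the block map of `Za` with the extra exit `v`, evaluated in the slot `v` at the block
map of `Zb` (p6, gen 34; P6-TWOEXIT-LEAN.md §21)

Setting of `C041BlockMapHangSets`.  For a colouring `ω = (ω₁, ω₂)` of the glued host, the per-exit vectors
`gvec` of the glued host and the per-slot vectors `fvec` of `Za⁺` (the slot `none` carrying the product of the
merged exits of `Zb`) turn the colouring term of the glued host into a term of `Za⁺` with the blocks of `Zb`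
alongside (`colTerm_hang_expand`, from `merged_hang`, `prod_blocks_hang`, `prod_subst`).  THE KEY IDENTITY
(`exitOf_colTerm_eq`): `exitOf (colTerm Zb …) r = fvec none · ∏_{B block of Zb} θ_R (∏_B gvec)` with `r` the
reached-status of `v` — the slot `v` of `Za⁺`, loaded with the colouring term of `Zb`, is the product of the merged
exits of `Zb` (reach flags conjoined with `r`) and of the joint vectors of the blocks of `Zb`.  When `v` is merged
the slot is a merged factor and the blocks of `Zb` are blocks of the glued host; when `v` is separated the slot sits
in the block of `v`, and `θ_R (P · θ_R Q) = θ_R P · θ_R Q` (`thR_mul_prod_thR`) moves the blocks of `Zb` out of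
it (`colTerm_hang`).  Summing over `ω₂` in the slot `v` (`blockMap_uplus_sum`) and then over `ω₁`:
**`blockMap_hang`**.  COROLLARY (`inCone_blockMap_hang`): the cone conjecture for block maps is closed under
hanging a host at a vertex — with THEOREM (WEDGE), THEOREM (SUBDIVISION), the reductions and THEOREM (PARALLEL
EDGE), CONJECTURE (BLOCK MAP) for every host follows from the simple 2-connected hosts with every non-terminal
vertex of degree `≥ 3` (the blocks of the block–cut tree, the cut vertices as extra exits), their contractions and
deletions.
-/

namespace PercRepro

namespace ZoneZ

namespace MultiExit

open ZoneData Pendant Finset TwoExit TreeClosure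

variable {V₁ E₁ U₁ W₁ V₂ E₂ U₂ W₂ : Type} (Za : ZoneData V₁ E₁ U₁ W₁) (Zb : ZoneData V₂ E₂ U₂ W₂)
  (v : V₁) (a₂ : V₂) [DecidableEq V₂] (a₁ : V₁)
variable {ι₁ ι₂ : Type} (u₁ : ι₁ → V₁) (u₂ : ι₂ → V₂) [Fintype ι₁] [Fintype ι₂] [DecidableEq ι₁] [DecidableEq ι₂]
  (ω : E₁ ⊕ E₂ → Bool) (w : ι₁ ⊕ ι₂ → Vec6)

/-! ## The per-exit vectors -/

/-- The per-exit vectors of the glued host. -/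
noncomputable def gvec : ι₁ ⊕ ι₂ → Vec6 :=
  fun k => exitOf (w k) ((wedge Za Zb v a₂).Rd (Sum.inl a₁) (wexits v a₂ u₁ u₂ k) ω)

/-- The per-slot vectors of `Za⁺`: the slot `none` carries the product of the merged exits of `Zb`. -/
noncomputable def fvec : Option ι₁ → Vec6 :=
  fun o => o.elim (∏ m ∈ merged Zb u₂ a₂ fun e => ω (Sum.inr e), gvec Za Zb v a₂ a₁ u₁ u₂ ω w (Sum.inr m))
    fun l => gvec Za Zb v a₂ a₁ u₁ u₂ ω w (Sum.inl l)

omit [Fintype ι₁] [Fintype ι₂] [DecidableEq ι₁] [DecidableEq ι₂] in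
/-- A left exit's vector. -/
theorem gvec_inl (k : ι₁) :
    gvec Za Zb v a₂ a₁ u₁ u₂ ω w (Sum.inl k) = exitOf (w (Sum.inl k)) (Za.Rd a₁ (u₁ k) fun e => ω (Sum.inl e)) := by
  unfold gvec
  simp only [Rd_hang_inl]

omit [Fintype ι₁] [Fintype ι₂] [DecidableEq ι₁] [DecidableEq ι₂] in
/-- A right exit's vector: the reach flag conjoined with that of `v`. -/
theorem gvec_inr (m : ι₂) :
    gvec Za Zb v a₂ a₁ u₁ u₂ ω w (Sum.inr m) =
      exitOf (w (Sum.inr m)) (Za.Rd a₁ v (fun e => ω (Sum.inl e)) ∧ Zb.Rd a₂ (u₂ m) fun e => ω (Sum.inr e)) := by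
  unfold gvec
  simp only [Rd_hang_inr]

omit [Fintype ι₁] [DecidableEq ι₁] [DecidableEq ι₂] in
/-- A `some` slot. -/
theorem fvec_some (l : ι₁) : fvec Za Zb v a₂ a₁ u₁ u₂ ω w (some l) = gvec Za Zb v a₂ a₁ u₁ u₂ ω w (Sum.inl l) := rfl

omit [Fintype ι₁] [DecidableEq ι₁] [DecidableEq ι₂] in
/-- The `none` slot. -/
theorem fvec_none :
    fvec Za Zb v a₂ a₁ u₁ u₂ ω w none =
      ∏ m ∈ merged Zb u₂ a₂ fun e => ω (Sum.inr e), gvec Za Zb v a₂ a₁ u₁ u₂ ω w (Sum.inr m) := rfl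

/-- The colouring term, unfolded (for rewriting one instance at a time). -/
theorem colTerm_eq {ι V E U W : Type} (Z : ZoneData V E U W) (u : ι → V) (a : V) [Fintype ι] (ω' : E → Bool)
    (w' : ι → Vec6) :
    colTerm Z u a ω' w' = (∏ k ∈ merged Z u a ω', exitOf (w' k) (Z.Rd a (u k) ω')) *
      ∏ B ∈ blocks Z u a ω', thR (∏ k ∈ B, exitOf (w' k) (Z.Rd a (u k) ω')) := rfl

/-- `exitOf` at a true flag. -/
theorem exitOf_of (x : Vec6) {r : Prop} (hr : r) : exitOf x r = x := by
  unfold exitOf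
  rw [if_pos hr]

/-- `exitOf` at a false flag. -/
theorem exitOf_of_not (x : Vec6) {r : Prop} (hr : ¬ r) : exitOf x r = thB x := by
  unfold exitOf
  rw [if_neg hr]

/-! ## The colouring term of the glued host, expanded -/

/-- **The colouring term of the glued host** read off `Za⁺` and the blocks of `Zb`. -/
theorem colTerm_hang_expand :
    colTerm (wedge Za Zb v a₂) (wexits v a₂ u₁ u₂) (Sum.inl a₁) ω w =
      (∏ o ∈ merged Za (uplus u₁ v) a₁ fun e => ω (Sum.inl e), fvec Za Zb v a₂ a₁ u₁ u₂ ω w o) *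
        ((∏ B ∈ blocks Za (uplus u₁ v) a₁ fun e => ω (Sum.inl e),
            thR (∏ o ∈ B, fvec Za Zb v a₂ a₁ u₁ u₂ ω w o)) *
          ∏ B ∈ blocks Zb u₂ a₂ fun e => ω (Sum.inr e),
            thR (∏ m ∈ B, gvec Za Zb v a₂ a₁ u₁ u₂ ω w (Sum.inr m))) := by
  rw [colTerm_eq]
  show (∏ k ∈ merged (wedge Za Zb v a₂) (wexits v a₂ u₁ u₂) (Sum.inl a₁) ω, gvec Za Zb v a₂ a₁ u₁ u₂ ω w k) *
    ∏ B ∈ blocks (wedge Za Zb v a₂) (wexits v a₂ u₁ u₂) (Sum.inl a₁) ω,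
      thR (∏ k ∈ B, gvec Za Zb v a₂ a₁ u₁ u₂ ω w k) = _
  rw [merged_hang, prod_blocks_hang Za Zb v a₂ a₁ u₁ u₂ ω (gvec Za Zb v a₂ a₁ u₁ u₂ ω w)]
  simp only [prod_subst]
  rfl

/-! ## The slot `v` loaded with the colouring term of `Zb` -/

/-- `exitOf` with a conjoined true flag. -/
theorem exitOf_and_of (x : Vec6) {r : Prop} (hr : r) (p : Prop) : exitOf x (r ∧ p) = exitOf x p := by
  unfold exitOf
  by_cases hp : p
  · rw [if_pos ⟨hr, hp⟩, if_pos hp]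
  · rw [if_neg (fun h => hp h.2), if_neg hp]

/-- `exitOf` with a conjoined false flag. -/
theorem exitOf_and_of_not (x : Vec6) {r : Prop} (hr : ¬ r) (p : Prop) : exitOf x (r ∧ p) = thB x := by
  unfold exitOf
  rw [if_neg (fun h => hr h.1)]

omit [Fintype ι₁] [DecidableEq ι₁] [DecidableEq ι₂] in
/-- **The key identity**: the slot `v`, loaded with the colouring term of `Zb` and read with the reach flag of
`v`, is the product of the merged exits of `Zb` (in the glued host) and of the joint vectors of the blocks of
`Zb` (in the glued host). -/
theorem exitOf_colTerm_eq :
    exitOf (colTerm Zb u₂ a₂ (fun e => ω (Sum.inr e)) fun m => w (Sum.inr m))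
        (Za.Rd a₁ v fun e => ω (Sum.inl e)) =
      fvec Za Zb v a₂ a₁ u₁ u₂ ω w none *
        ∏ B ∈ blocks Zb u₂ a₂ fun e => ω (Sum.inr e),
          thR (∏ m ∈ B, gvec Za Zb v a₂ a₁ u₁ u₂ ω w (Sum.inr m)) := by
  rw [fvec_none]
  simp only [gvec_inr]
  rw [colTerm_eq]
  by_cases hr : Za.Rd a₁ v fun e => ω (Sum.inl e)
  · rw [exitOf_of _ hr]
    simp only [exitOf_and_of _ hr]
  · rw [exitOf_of_not _ hr, thB_mul, thB_prod, thB_prod]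
    simp only [exitOf_and_of_not _ hr, thB_exitOf, thB_thR, thB_prod]

/-! ## THE PER-COLOURING IDENTITY -/

omit [Fintype ι₁] [DecidableEq ι₁] [DecidableEq ι₂] in
/-- The per-slot vectors of `Za⁺` loaded with `X` at `none`. -/
theorem uplus_vec_some (X : Vec6) (l : ι₁) :
    exitOf (wplus X (fun k => w (Sum.inl k)) (some l)) (Za.Rd a₁ (uplus u₁ v (some l)) fun e => ω (Sum.inl e)) =
      fvec Za Zb v a₂ a₁ u₁ u₂ ω w (some l) := by
  rw [fvec_some, gvec_inl, wplus_some, uplus_some]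

/-- **THE PER-COLOURING IDENTITY**: the colouring term of the glued host is the colouring term of `Za⁺` with the
colouring term of `Zb` in the slot `v`. -/
theorem colTerm_hang :
    colTerm (wedge Za Zb v a₂) (wexits v a₂ u₁ u₂) (Sum.inl a₁) ω w =
      colTerm Za (uplus u₁ v) a₁ (fun e => ω (Sum.inl e))
        (wplus (colTerm Zb u₂ a₂ (fun e => ω (Sum.inr e)) fun m => w (Sum.inr m)) fun k => w (Sum.inl k)) := by
  rw [colTerm_hang_expand, colTerm_eq Za (uplus u₁ v)]
  set X := colTerm Zb u₂ a₂ (fun e => ω (Sum.inr e)) fun m => w (Sum.inr m) with hX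
  set F := fvec Za Zb v a₂ a₁ u₁ u₂ ω w with hF
  set KB := ∏ B ∈ blocks Zb u₂ a₂ fun e => ω (Sum.inr e),
    thR (∏ m ∈ B, gvec Za Zb v a₂ a₁ u₁ u₂ ω w (Sum.inr m)) with hKB
  -- the per-slot vectors of `Za⁺` agree with `F` away from `none`
  have hsome : ∀ o : Option ι₁, o ≠ none →
      exitOf (wplus X (fun k => w (Sum.inl k)) o) (Za.Rd a₁ (uplus u₁ v o) fun e => ω (Sum.inl e)) = F o := by
    intro o ho
    rcases o with _ | l
    · exact absurd rfl ho
    · exact uplus_vec_some Za Zb v a₂ a₁ u₁ u₂ ω w _ l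
  have hnone : exitOf (wplus X (fun k => w (Sum.inl k)) none) (Za.Rd a₁ (uplus u₁ v none) fun e => ω (Sum.inl e)) =
      F none * KB := by
    rw [wplus_none, uplus_none, hX, hF, hKB]
    exact exitOf_colTerm_eq Za Zb v a₂ a₁ u₁ u₂ ω w
  by_cases hv : Za.Mg a₁ v fun e => ω (Sum.inl e)
  · -- `v` merged: the slot `v` is a merged factor, no block of `Za⁺` contains `none`
    have hmem : none ∈ merged Za (uplus u₁ v) a₁ fun e => ω (Sum.inl e) := by
      rw [mem_merged, uplus_none]
      exact hv
    have hblk : ∀ B ∈ blocks Za (uplus u₁ v) a₁ fun e => ω (Sum.inl e), none ∉ B := by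
      intro B hB hn
      obtain ⟨k, -, rfl⟩ := (mem_blocks _ _ _ _ B).1 hB
      exact ((mem_blk _ _ _ _ k none).1 hn).1 (by rw [uplus_none]; exact hv)
    have e1 : ∏ o ∈ (merged Za (uplus u₁ v) a₁ fun e => ω (Sum.inl e)).erase none,
        exitOf (wplus X (fun k => w (Sum.inl k)) o) (Za.Rd a₁ (uplus u₁ v o) fun e => ω (Sum.inl e)) =
        ∏ o ∈ (merged Za (uplus u₁ v) a₁ fun e => ω (Sum.inl e)).erase none, F o :=
      Finset.prod_congr rfl fun o ho => hsome o (Finset.ne_of_mem_erase ho)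
    have e2 : ∏ B ∈ blocks Za (uplus u₁ v) a₁ fun e => ω (Sum.inl e),
        thR (∏ o ∈ B, exitOf (wplus X (fun k => w (Sum.inl k)) o)
          (Za.Rd a₁ (uplus u₁ v o) fun e => ω (Sum.inl e))) =
        ∏ B ∈ blocks Za (uplus u₁ v) a₁ fun e => ω (Sum.inl e), thR (∏ o ∈ B, F o) :=
      Finset.prod_congr rfl fun B hB => by
        rw [Finset.prod_congr rfl fun o ho => hsome o (fun h => hblk B hB (h ▸ ho))]
    rw [← Finset.mul_prod_erase _ F hmem,
      ← Finset.mul_prod_erase _ (fun o => exitOf (wplus X (fun k => w (Sum.inl k)) o)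
        (Za.Rd a₁ (uplus u₁ v o) fun e => ω (Sum.inl e))) hmem, hnone, e1, e2]
    ring
  · -- `v` separated: the slot `v` sits in the block of `v`; the blocks of `Zb` move out of it
    have hnot : none ∉ merged Za (uplus u₁ v) a₁ fun e => ω (Sum.inl e) := by
      rw [mem_merged, uplus_none]
      exact hv
    have hBv : blk Za (uplus u₁ v) a₁ (fun e => ω (Sum.inl e)) none ∈
        blocks Za (uplus u₁ v) a₁ fun e => ω (Sum.inl e) :=
      (mem_blocks _ _ _ _ _).2 ⟨none, by rw [uplus_none]; exact hv, rfl⟩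
    have hnBv : none ∈ blk Za (uplus u₁ v) a₁ (fun e => ω (Sum.inl e)) none :=
      self_mem_blk _ _ _ _ none (by rw [uplus_none]; exact hv)
    have hother : ∀ B ∈ (blocks Za (uplus u₁ v) a₁ fun e => ω (Sum.inl e)).erase
        (blk Za (uplus u₁ v) a₁ (fun e => ω (Sum.inl e)) none), none ∉ B := by
      intro B hB hn
      obtain ⟨hne, hB⟩ := Finset.mem_erase.1 hB
      obtain ⟨k, -, rfl⟩ := (mem_blocks _ _ _ _ B).1 hB
      exact hne (blk_eq_of_mem _ _ _ _ hn).symm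
    have e1 : ∏ o ∈ merged Za (uplus u₁ v) a₁ fun e => ω (Sum.inl e),
        exitOf (wplus X (fun k => w (Sum.inl k)) o) (Za.Rd a₁ (uplus u₁ v o) fun e => ω (Sum.inl e)) =
        ∏ o ∈ merged Za (uplus u₁ v) a₁ fun e => ω (Sum.inl e), F o :=
      Finset.prod_congr rfl fun o ho => hsome o (fun h => hnot (h ▸ ho))
    have e2 : ∏ B ∈ (blocks Za (uplus u₁ v) a₁ fun e => ω (Sum.inl e)).erase
        (blk Za (uplus u₁ v) a₁ (fun e => ω (Sum.inl e)) none),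
        thR (∏ o ∈ B, exitOf (wplus X (fun k => w (Sum.inl k)) o)
          (Za.Rd a₁ (uplus u₁ v o) fun e => ω (Sum.inl e))) =
        ∏ B ∈ (blocks Za (uplus u₁ v) a₁ fun e => ω (Sum.inl e)).erase
          (blk Za (uplus u₁ v) a₁ (fun e => ω (Sum.inl e)) none), thR (∏ o ∈ B, F o) :=
      Finset.prod_congr rfl fun B hB => by
        rw [Finset.prod_congr rfl fun o ho => hsome o (fun h => hother B hB (h ▸ ho))]
    have e3 : ∏ o ∈ (blk Za (uplus u₁ v) a₁ (fun e => ω (Sum.inl e)) none).erase none,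
        exitOf (wplus X (fun k => w (Sum.inl k)) o) (Za.Rd a₁ (uplus u₁ v o) fun e => ω (Sum.inl e)) =
        ∏ o ∈ (blk Za (uplus u₁ v) a₁ (fun e => ω (Sum.inl e)) none).erase none, F o :=
      Finset.prod_congr rfl fun o ho => hsome o (Finset.ne_of_mem_erase ho)
    rw [e1, ← Finset.mul_prod_erase _ (fun B => thR (∏ o ∈ B, F o)) hBv,
      ← Finset.mul_prod_erase _ (fun B => thR (∏ o ∈ B, exitOf (wplus X (fun k => w (Sum.inl k)) o)
        (Za.Rd a₁ (uplus u₁ v o) fun e => ω (Sum.inl e)))) hBv, e2,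
      ← Finset.mul_prod_erase _ F hnBv,
      ← Finset.mul_prod_erase _ (fun o => exitOf (wplus X (fun k => w (Sum.inl k)) o)
        (Za.Rd a₁ (uplus u₁ v o) fun e => ω (Sum.inl e))) hnBv, hnone, e3, hKB,
      mul_right_comm (F none), thR_mul_prod_thR]
    ring

/-! ## THEOREM (HANG) -/

variable [Fintype E₁] [DecidableEq E₁] [Fintype E₂] [DecidableEq E₂]

/-- **THEOREM (HANG)**: the block map of `Zb` hung at the vertex `v` of `Za` is the block map of `Za` with the
extra exit `v`, evaluated in the slot `v` at the block map of `Zb`. -/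
theorem blockMap_hang :
    blockMap (wedge Za Zb v a₂) (wexits v a₂ u₁ u₂) (Sum.inl a₁) w =
      blockMap Za (uplus u₁ v) a₁ (wplus (blockMap Zb u₂ a₂ fun m => w (Sum.inr m)) fun k => w (Sum.inl k)) := by
  rw [blockMap_eq_sum_colTerm (Zb) u₂ a₂, blockMap_uplus_sum, blockMap_eq_sum_colTerm,
    ← Fintype.sum_equiv (Equiv.sumArrowEquivProdArrow E₁ E₂ Bool).symm
      (fun p => colTerm (wedge Za Zb v a₂) (wexits v a₂ u₁ u₂) (Sum.inl a₁)
        ((Equiv.sumArrowEquivProdArrow E₁ E₂ Bool).symm p) w) _ (fun _ => rfl),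
    Fintype.sum_prod_type, Finset.sum_comm]
  refine Finset.sum_congr rfl fun ω₂ _ => ?_
  rw [blockMap_eq_sum_colTerm]
  refine Finset.sum_congr rfl fun ω₁ _ => ?_
  exact colTerm_hang Za Zb v a₂ a₁ u₁ u₂ (Sum.elim ω₁ ω₂) w

/-- **The cone conjecture for block maps is closed under hanging a host at a vertex.** -/
theorem inCone_blockMap_hang
    (h : ∀ X, InCone X → InCone (blockMap Za (uplus u₁ v) a₁ (wplus X fun k => w (Sum.inl k))))
    (hb : InCone (blockMap Zb u₂ a₂ fun m => w (Sum.inr m))) :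
    InCone (blockMap (wedge Za Zb v a₂) (wexits v a₂ u₁ u₂) (Sum.inl a₁) w) := by
  rw [blockMap_hang]
  exact h _ hb

end MultiExit

end ZoneZ

end PercRepro
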